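import Summits.QuantumFields.GaugeBoot.SOMasterLoopOperations
import Summits.QuantumFields.GaugeBoot.SOMasterLoopRegularity
import HarnessLib

/-!
# The spectator product and the boundary-action derivative along the one-link flow (gauge-boot, ADDENDUM 27 part M5a)

HONEST FRAMING (cell `pub-gaugeboot`, page 1 of every file): the venture produces certified bounds
on lattice expectations at stated coupling, gauge group, dimension and torus size; NOT a mass gap,
NOT a continuum limit, NOT a string tension; NOT Yang–Mills-summit-bearing (barriers
`FixedCouplingUltralocality`, `PerturbativeInvisibility`).  Calculus bookkeeping; nothing about the large-`N` limit is
claimed here.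

## Content

Eighth file of the lane's programme on the tree's NAMED FACT `Chatterjee2019LargeN.UnsymmetrizedMasterLoopEquation`
(Chatterjee, CMP 366 (2019), Theorem 8.1).  The test function of the one-link identity is
`tr(insProd_x(l₁)) · Π_{r ≥ 2} W_{l_r}`; this file prepares the second factor and the action derivative:

* `prodW rest U = Π_r tr holC_U(l_r)` (`= W_{l₂} ⋯ W_{lₙ}` in `ℂ`, `prodW_eq_ofReal_wilsonProd`), its derivative along
  the flow `prodW'` = Σ_r (Π_{r' ≠ r} W_{l_{r'}}) · Σ_z tr(insProd_z(l_r)) (`hasDerivAt_prodW`), continuity and the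
  cylinder property;
* `plaquetteObs_eq_wilsonLoopVar_plaquetteWord` — the tree's plaquette observable `Re tr ρ(U_p)` IS the Wilson loop
  variable of Chatterjee's `plaquetteWord p` (the tree traverses the plaquette backwards: `invRev`, same trace);
* `actionDeriv' ε X U = −Σ_{p ∋ ε} Re Σ_z tr(insProd_z(plaquetteWord p))` and ★ `hasDerivAt_wilsonBoundaryAction'`:
  it is the derivative of the boundary Wilson action `S_ε` along the flow (`S'` of the one-link identity).

Everything is `[folklore]`.
-/

noncomputable section

open NormedSpace MeasureTheory
open scoped Matrix.Norms.Frobenius Matrix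
open Literature.Probability.LatticeModels (Site)
open Literature.MathematicalPhysics.QuantumLattice (LGConfig ZdEdge ZdPlaquette plaquettesTouching plaquetteEdges
  plaquetteObs plaquetteHolonomyZd wilsonBoundaryAction)
open Literature.MathematicalPhysics.QuantumFieldTheory (Chatterjee2019LargeN.Word Chatterjee2019LargeN.wordHolonomy)
open Literature.MathematicalPhysics.QuantumFieldTheory.Chatterjee2019LargeN
  (SO soRep soRep_apply DEdge LoopSeq wilsonLoopVar wilsonProd plaquetteWord)

namespace Summit.QuantumFields.GaugeBoot

namespace SOMasterLoop

variable {d N : ℕ}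

/-! ## The spectator product -/

section Rest

variable (ε : ZdEdge d) (X : Matrix (Fin N) (Fin N) ℂ)

/-- `Π_r tr holC_U(l_r)` over the spectator loops (in `ℂ`). [folklore] -/
def prodW (rest : LoopSeq d) (U : LGConfig d (SO N)) : ℂ := ∏ r : Fin rest.length, (holC U (rest.get r)).trace

/-- Its flow derivative: `Σ_r (Π_{r' ≠ r} tr holC(l_{r'})) · Σ_z tr(insProd_z(l_r))`. [folklore] -/
def prodW' (rest : LoopSeq d) (U : LGConfig d (SO N)) : ℂ :=
  ∑ r : Fin rest.length, (∏ r' ∈ Finset.univ.erase r, (holC U (rest.get r')).trace) *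
    ∑ z : Fin (rest.get r).length, (insProd ε X (rest.get r) z U).trace

/-- A list product as a product over `Fin`. [folklore] -/
theorem prod_map_eq_prod_fin {α M : Type*} [CommMonoid M] (f : α → M) :
    ∀ s : List α, (s.map f).prod = ∏ r : Fin s.length, f (s.get r)
  | [] => by simp
  | a :: s => by
    rw [List.map_cons, List.prod_cons, prod_map_eq_prod_fin f s]
    show _ = ∏ r : Fin (s.length + 1), f ((a :: s).get r)
    rw [Fin.prod_univ_succ]
    rfl

/-- `prodW = W_{l₂} ⋯ W_{lₙ}` (the real product read in `ℂ`). [folklore] -/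
theorem prodW_eq_ofReal_wilsonProd (rest : LoopSeq d) (U : LGConfig d (SO N)) :
    prodW rest U = ((wilsonProd N rest U : ℝ) : ℂ) := by
  rw [prodW, wilsonProd, prod_map_eq_prod_fin, Complex.ofReal_prod]
  simp only [trace_holC]

/-- The trace of `holC` along the flow has derivative the insertion-trace sum. [folklore] -/
theorem hasDerivAt_trace_holC {k : ℝ → SO N} (hk : ∀ s t, k (s + t) = k s * k t)
    (hX : ∀ t, soRep N (k t) = exp ((t : ℂ) • X)) (U : LGConfig d (SO N)) (w : Chatterjee2019LargeN.Word d) :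
    HasDerivAt (fun t : ℝ => (holC (Function.update U ε (k t * U ε)) w).trace)
      (∑ z : Fin w.length, (insProd ε X w z U).trace) 0 := by
  have h := hasDerivAt_trace (hasDerivAt_prod_letterMat hk hX U w (ε := ε))
  rw [Matrix.trace_sum] at h
  exact h

/-- ★ **The spectator product is differentiable along the flow, with derivative `prodW'`.** [folklore] -/
theorem hasDerivAt_prodW {k : ℝ → SO N} (hk : ∀ s t, k (s + t) = k s * k t)
    (hX : ∀ t, soRep N (k t) = exp ((t : ℂ) • X)) (rest : LoopSeq d) (U : LGConfig d (SO N)) :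
    HasDerivAt (fun t : ℝ => prodW rest (Function.update U ε (k t * U ε))) (prodW' ε X rest U) 0 := by
  have h := HasDerivAt.fun_finsetProd (u := (Finset.univ : Finset (Fin rest.length)))
    (fun r _ => hasDerivAt_trace_holC ε X hk hX U (rest.get r))
  simp only [prodW, prodW']
  refine h.congr_deriv (Finset.sum_congr rfl fun r _ => ?_)
  rw [smul_eq_mul, TiltedRP.update_shift_zero hk]

/-- The spectator product is continuous. [folklore] -/
theorem continuous_prodW (rest : LoopSeq d) : Continuous fun U : LGConfig d (SO N) => prodW rest U := by
  unfold prodW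
  exact continuous_finsetProd _ fun r _ => (continuous_prodLetterMatTrace (rest.get r))
where
  /-- `U ↦ tr holC_U(w)` is continuous. [folklore] -/
  continuous_prodLetterMatTrace (w : Chatterjee2019LargeN.Word d) :
      Continuous fun U : LGConfig d (SO N) => (holC U w).trace :=
    (continuous_prod_letterMat w).matrix_trace

/-- Its derivative is continuous. [folklore] -/
theorem continuous_prodW' (rest : LoopSeq d) : Continuous fun U : LGConfig d (SO N) => prodW' ε X rest U := by
  unfold prodW'
  refine continuous_finsetSum _ fun r _ => (continuous_finsetProd _ fun r' _ => ?_).mul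
    (continuous_finsetSum _ fun z _ => (continuous_insProd ε X _ z).matrix_trace)
  exact (continuous_prod_letterMat _).matrix_trace

/-- The edge support of a loop sequence. [folklore] -/
def supportSeq (s : LoopSeq d) : Finset (ZdEdge d) := Finset.univ.biUnion fun r : Fin s.length => support (s.get r)

/-- Each component's support lies in the sequence's support. [folklore] -/
theorem support_get_subset (s : LoopSeq d) (r : Fin s.length) : support (s.get r) ⊆ supportSeq s :=
  Finset.subset_biUnion_of_mem (fun r => support (s.get r)) (Finset.mem_univ r)

/-- The spectator product is a cylinder function on the sequence's support. [folklore] -/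
theorem dependsOn_prodW (rest : LoopSeq d) :
    DependsOn (fun U : LGConfig d (SO N) => prodW rest U) (↑(supportSeq rest) : Set (ZdEdge d)) := by
  intro U V h
  change prodW rest U = prodW rest V
  unfold prodW
  refine Finset.prod_congr rfl fun r _ => ?_
  have := dependsOn_prod_letterMat (N := N) (rest.get r) (fun e he => h e (support_get_subset rest r he))
  exact congrArg Matrix.trace this

/-- Its derivative is a cylinder function on the sequence's support. [folklore] -/
theorem dependsOn_prodW' (rest : LoopSeq d) :
    DependsOn (fun U : LGConfig d (SO N) => prodW' ε X rest U) (↑(supportSeq rest) : Set (ZdEdge d)) := by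
  intro U V h
  change prodW' ε X rest U = prodW' ε X rest V
  unfold prodW'
  refine Finset.sum_congr rfl fun r _ => ?_
  congr 1
  · refine Finset.prod_congr rfl fun r' _ => ?_
    exact congrArg Matrix.trace
      (dependsOn_prod_letterMat (N := N) (rest.get r') (fun e he => h e (support_get_subset rest r' he)))
  · refine Finset.sum_congr rfl fun z _ => ?_
    exact congrArg Matrix.trace (dependsOn_insProd ε X (rest.get r) z (fun e he => h e (support_get_subset rest r he)))

end Rest

/-! ## The boundary action through Chatterjee's plaquette words -/

section Action

variable (ε : ZdEdge d) (X : Matrix (Fin N) (Fin N) ℂ)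

/-- The tree's plaquette holonomy is the holonomy of the REVERSED plaquette word `(plaquetteWord p)⁻¹`. [folklore] -/
theorem plaquetteHolonomyZd_eq_wordHolonomy (U : LGConfig d (SO N)) (p : ZdPlaquette d) :
    plaquetteHolonomyZd U p.1 p.2.1.1 p.2.1.2 =
      Chatterjee2019LargeN.wordHolonomy U (FreeGroup.invRev (plaquetteWord p)) := by
  simp [plaquetteHolonomyZd, Chatterjee2019LargeN.wordHolonomy, plaquetteWord, FreeGroup.invRev, mul_assoc]

/-- **The plaquette observable is the Wilson loop variable of Chatterjee's plaquette word** (`SO(N)`: reversing the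
orientation does not change the trace). [folklore] -/
theorem plaquetteObs_eq_wilsonLoopVar (U : LGConfig d (SO N)) (p : ZdPlaquette d) :
    plaquetteObs (soRep N) p.1 p.2.1.1 p.2.1.2 U = wilsonLoopVar N (plaquetteWord p) U := by
  have h : ((plaquetteObs (soRep N) p.1 p.2.1.1 p.2.1.2 U : ℝ) : ℂ) = ((wilsonLoopVar N (plaquetteWord p) U : ℝ) : ℂ) := by
    rw [plaquetteObs, plaquetteHolonomyZd_eq_wordHolonomy, ← holC_eq_soRep, holC_invRev, Matrix.trace_transpose,
      trace_holC, Complex.ofReal_re]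
  exact_mod_cast h

/-- The plaquette observable as the real part of a complex trace. [folklore] -/
theorem plaquetteObs_eq_re_trace_holC (U : LGConfig d (SO N)) (p : ZdPlaquette d) :
    plaquetteObs (soRep N) p.1 p.2.1.1 p.2.1.2 U = ((holC U (plaquetteWord p)).trace).re := by
  rw [plaquetteObs_eq_wilsonLoopVar, trace_holC, Complex.ofReal_re]

/-- The flow derivative of the boundary action: `−Σ_{p ∋ ε} Re Σ_z tr(insProd_z(plaquetteWord p))`. [folklore] -/
def actionDeriv' (U : LGConfig d (SO N)) : ℝ :=
  -∑ p ∈ plaquettesTouching ({ε} : Finset (ZdEdge d)),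
    (∑ z : Fin (plaquetteWord p).length, (insProd ε X (plaquetteWord p) z U).trace).re

variable {ε X} {k : ℝ → SO N}

/-- ★ **The boundary Wilson action `S_ε` is differentiable along the flow with derivative `actionDeriv'`.** [folklore] -/
theorem hasDerivAt_wilsonBoundaryAction' (hk : ∀ s t, k (s + t) = k s * k t)
    (hX : ∀ t, soRep N (k t) = exp ((t : ℂ) • X)) (U : LGConfig d (SO N)) :
    HasDerivAt (fun t : ℝ => wilsonBoundaryAction (soRep N) {ε} (Function.update U ε (k t * U ε)))
      (actionDeriv' ε X U) 0 := by
  have hp : ∀ p ∈ plaquettesTouching ({ε} : Finset (ZdEdge d)), HasDerivAt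
      (fun t : ℝ => ((N : ℝ) - plaquetteObs (soRep N) p.1 p.2.1.1 p.2.1.2 (Function.update U ε (k t * U ε))))
      (-(∑ z : Fin (plaquetteWord p).length, (insProd ε X (plaquetteWord p) z U).trace).re) 0 := by
    intro p _
    have h1 := hasDerivAt_trace_holC ε X hk hX U (plaquetteWord p)
    set D : ℂ := ∑ z : Fin (plaquetteWord p).length, (insProd ε X (plaquetteWord p) z U).trace with hD
    have h2 : HasDerivAt (fun t : ℝ => ((holC (Function.update U ε (k t * U ε)) (plaquetteWord p)).trace).re)
        D.re 0 := by
      simpa [Function.comp_def] using (Complex.reCLM.hasFDerivAt.comp_hasDerivAt (0 : ℝ) h1)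
    simp only [plaquetteObs_eq_re_trace_holC]
    exact h2.const_sub _
  unfold wilsonBoundaryAction actionDeriv'
  have h := HasDerivAt.fun_sum hp
  rw [← Finset.sum_neg_distrib]
  exact h

/-- `actionDeriv'` is continuous. [folklore] -/
theorem continuous_actionDeriv' : Continuous fun U : LGConfig d (SO N) => actionDeriv' ε X U := by
  unfold actionDeriv'
  exact (continuous_finsetSum _ fun p _ => Complex.continuous_re.comp
    (continuous_finsetSum _ fun z _ => (continuous_insProd ε X _ z).matrix_trace)).neg

end Action

end SOMasterLoop

end Summit.QuantumFields.GaugeBoot
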